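import Mathlib
import HarnessLib
import Summits.CriticalPhenomena.SAWScalingLimit.Theses.SAWDevelopingMap

/-!
# Sketch — crux-ideate stmt-CriticalPhenomena-10472 (ObservableToSLE), ideator 3, round 1

First lemmas of the two idea cards
`Ideas/source-residue-restriction-pinning.md` (card A) and
`Ideas/target-transport-short-chord.md` (card B), stated over existing declarations.
Nothing here is proved; every `def … : Prop` must elaborate (`lean check` rc 0).
-/

namespace Summit.CriticalPhenomena.SAWScalingLimit.Cruxes.ObservableToSLE.Ideator3

open scoped BigOperators Topology
open Filter Set
open Literature.Probability.LatticeModels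
open Literature.Probability.RandomPlanarGeometry
open Literature.Probability.RandomPlanarGeometry.SAW

/-- Shorthand: the critical spin-`5/8` observable of the domain `Λ` with source `a`. -/
noncomputable def F (Λ : Finset HexVertex) (a : Sym2 HexVertex) : Sym2 HexVertex → ℂ :=
  hexParafermionicObservable Λ a hexCriticalFugacity (5 / 8)

/-- Shorthand: the critical boundary-to-`z` partition function `Z_Λ(a → z) = Σ_γ x_c^{ℓ(γ)}`
(the spin-`0` observable, real by `hexParafermionicObservable_zero_spin`). -/
noncomputable def Z (Λ : Finset HexVertex) (a z : Sym2 HexVertex) : ℝ :=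
  (hexParafermionicObservable Λ a hexCriticalFugacity 0 z).re

/-- CARD A, first lemma (restriction exactness in observable form / phase alignment).
For nested simply connected domains `Λ' ⊆ Λ` sharing the boundary source `a`, at every COMMON
boundary mid-edge `p` the two observables have the same (deterministic-winding) phase and moduli
`Z_{Λ'}(a→p) ≤ Z_Λ(a→p)`: `F_{Λ'}(p) = t · F_Λ(p)` with `t = P_Λ^{a→p}(γ ⊂ Λ') ∈ [0,1]`.
This is what makes the near-source terms of the differenced DCS sum rule a POSITIVE combination. -/
def PhaseAlignment : Prop :=
  ∀ (Λ Λ' : Finset HexVertex) (a p : Sym2 HexVertex), Λ' ⊆ Λ →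
    hexDomainSimplyConnected Λ → hexDomainSimplyConnected Λ' →
    a ∈ hexDomainBoundary Λ → a ∈ hexDomainBoundary Λ' →
    p ∈ hexDomainBoundary Λ → p ∈ hexDomainBoundary Λ' →
      ∃ t : ℝ, 0 ≤ t ∧ t ≤ 1 ∧ F Λ' a p = (t : ℂ) * F Λ a p ∧
        Z Λ' a p = t * Z Λ a p

/-- CARD A, the exact boundary sum rule for a general simply connected domain (DCS (5) beyond
strips; in the tree for half-plane-contained domains as `SAW.HV.boundary_sum`): summing Lemma 1
over `v ∈ Λ` kills interior mid-edges (the midpoint is the mean of the two centres), leaving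
`Σ_{p ∈ ∂Λ} (p − v_p) F(p) = 0`, the term of `p = a` being `(a − v_a) · 1`. -/
def BoundarySumRule : Prop :=
  DuminilCopinSmirnov2012_lemma1 →
    ∀ (Λ : Finset HexVertex), hexDomainSimplyConnected Λ → ∀ a ∈ hexDomainBoundary Λ,
      (∑ v ∈ Λ, ∑ᶠ (w : HexVertex) (_ : hexGraph.Adj v w ∧ w ∉ Λ),
          (hexMidpoint s(v, w) - hexCenter v) * F Λ a s(v, w)) = 0

/-- CARD A, the differenced sum rule (Λ' ⊆ Λ, common source): the boundary sums of the two
domains are both `0`; on common boundary mid-edges the difference `F_Λ − F_{Λ'}` is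
`(1 − t_p) F_Λ(p)`, a nonnegative multiple of the common phase (`PhaseAlignment`) — the mass of
walks `a → p` that visit `Λ ∖ Λ'`. Stated as the vanishing of the difference of the two sums. -/
def DifferencedSumRule : Prop :=
  DuminilCopinSmirnov2012_lemma1 →
    ∀ (Λ Λ' : Finset HexVertex), Λ' ⊆ Λ → hexDomainSimplyConnected Λ →
      hexDomainSimplyConnected Λ' → ∀ a ∈ hexDomainBoundary Λ, a ∈ hexDomainBoundary Λ' →
      (∑ v ∈ Λ, ∑ᶠ (w : HexVertex) (_ : hexGraph.Adj v w ∧ w ∉ Λ),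
          (hexMidpoint s(v, w) - hexCenter v) * F Λ a s(v, w)) -
      (∑ v ∈ Λ', ∑ᶠ (w : HexVertex) (_ : hexGraph.Adj v w ∧ w ∉ Λ'),
          (hexMidpoint s(v, w) - hexCenter v) * F Λ' a s(v, w)) = 0

/-- CARD B, first lemma (restriction monotonicity of boundary partition functions): shrinking the
domain can only lose walks. With `PhaseAlignment` this is `P_Λ(γ ⊂ Λ') = Z_{Λ'}(a→b)/Z_Λ(a→b)`. -/
def RestrictionMonotone : Prop :=
  ∀ (Λ Λ' : Finset HexVertex) (a z : Sym2 HexVertex), Λ' ⊆ Λ → 0 ≤ Z Λ' a z ∧ Z Λ' a z ≤ Z Λ a z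

/-- CARD B, the load-bearing probabilistic input SHORT-CHORD LOCALITY, typed: along a flat zigzag
bottom row through the source point `apt`, critical chords from `a_δ` to a boundary mid-edge
`c_δ(r)` at distance `≤ r` visit the removed far region `Λ_δ ∖ Λ'_δ` (at distance `≥ ρ` from
`apt`) with probability `→ 0` as `r → 0`, uniformly in the mesh (limsup over `δ → 0⁺` first). -/
def ShortChordLocality : Prop :=
  ∀ (Λ Λ' : ℝ → Finset HexVertex) (m : ℝ → ℤ) (a : ℝ → Sym2 HexVertex)
    (c : ℝ → ℝ → Sym2 HexVertex) (apt : ℂ) (ρ : ℝ), 0 < ρ →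
    (∀ᶠ δ : ℝ in 𝓝[>] 0, Λ' δ ⊆ Λ δ ∧ hexDomainSimplyConnected (Λ δ) ∧
      hexDomainSimplyConnected (Λ' δ) ∧ a δ ∈ hexDomainBoundary (Λ δ) ∧
      a δ ∈ hexDomainBoundary (Λ' δ) ∧
      (∀ v ∈ Λ δ, v ∉ Λ' δ → ρ ≤ dist ((δ : ℂ) * hexCenter v) apt) ∧
      (∀ v : HexVertex, (δ : ℂ) * hexCenter v ∈ Metric.ball apt ρ →
        ((v ∈ Λ δ ↔ m δ ≤ v.1 1) ∧ (v ∈ Λ' δ ↔ m δ ≤ v.1 1)))) →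
    Tendsto (fun δ : ℝ => (δ : ℂ) * hexMidpoint (a δ)) (𝓝[>] 0) (𝓝 apt) →
    (∀ r : ℝ, 0 < r → ∀ᶠ δ : ℝ in 𝓝[>] 0, c δ r ∈ hexDomainBoundary (Λ δ) ∧
      c δ r ∈ hexDomainBoundary (Λ' δ) ∧ dist ((δ : ℂ) * hexMidpoint (c δ r)) apt ≤ r ∧
      0 < Z (Λ δ) (a δ) (c δ r)) →
    Tendsto (fun r : ℝ => Filter.limsup (fun δ : ℝ => 1 - Z (Λ' δ) (a δ) (c δ r) / Z (Λ δ) (a δ) (c δ r))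
      (𝓝[>] 0)) (𝓝[>] 0) (𝓝 0)

/-- CARD B, target transport made abstract (the algebra of the free consequence of two instances
of `HexObservableLimit` with the same numerator `A δ = δ² Σ ψ F_δ`): if `A/F(b_δ) → C e^{-σ L_b}`
and `A/F(c_δ) → C e^{-σ L_c}` with `C ≠ 0`, then `F(c_δ)/F(b_δ) → e^{σ (L_c - L_b)}`… stated for the
moduli, which is what the restriction cocycle uses. -/
def TargetTransportAlgebra : Prop :=
  ∀ (A Fb Fc : ℝ → ℂ) (C : ℂ) (Lb Lc : ℂ), C ≠ 0 →
    (∀ᶠ δ : ℝ in 𝓝[>] 0, Fb δ ≠ 0 ∧ Fc δ ≠ 0) →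
    Tendsto (fun δ => A δ / Fb δ) (𝓝[>] 0) (𝓝 (C * Complex.exp (-(5 / 8 : ℂ) * Lb))) →
    Tendsto (fun δ => A δ / Fc δ) (𝓝[>] 0) (𝓝 (C * Complex.exp (-(5 / 8 : ℂ) * Lc))) →
    Tendsto (fun δ => ‖Fc δ‖ / ‖Fb δ‖) (𝓝[>] 0)
      (𝓝 (Real.exp ((5 / 8 : ℝ) * (Lc.re - Lb.re))))

/-- Both cards conclude through the crux as typed. -/
example : Prop := Summit.CriticalPhenomena.SAWScalingLimit.Theses.SAWDevelopingMap.ObservableToSLE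

end Summit.CriticalPhenomena.SAWScalingLimit.Cruxes.ObservableToSLE.Ideator3
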